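import Summits.CriticalPhenomena.PercolationContinuityZ3.Theorems.PercNearOneGluingNoHeavyLowerTailSahiTwoLevelTopAbsorbing
import Summits.CriticalPhenomena.PercolationContinuityZ3.Theorems.PercNearOneGluingNoHeavyLowerTailSahiAbsorbedKahnStratum
import Mathlib.Tactic.Linarith
import HarnessLib

/-!
# Kahn's inequality on the RECURSIVELY-ABSORBING class: a top-absorbing coordinate is a good coordinate

Support file of the one-cut programme (crux `NoHeavyLowerTail`, stmt-CriticalPhenomena-4575; master-family line P2 = Sahi's algebraic route,
seat `prim-masterthm-p2` gen 21; memo `run/shared/lean/prim/prim-masterthm/FROM-prim-masterthm-p2-g21-TOP-ABSORBING.md` §8).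
No definition, no sorry; axioms standard.

THE STEP (`sahiE3_nonneg_of_topAbsorbingAt`).  Let `A, B, C` be increasing events of a finite cube, `μ = prodBernoulli q`, `e` a coordinate,
and suppose that among the `1`-sections `A¹, B¹, C¹` along `e` ONE CONTAINS THE MEET OF THE OTHER TWO.  Then the top two-level form of the
sections is `≥ 0` UNCONDITIONALLY (`…SahiTwoLevelTopAbsorbing.twoLevelPlus_nonneg_of_topAbsorbing`: move (T+) to the sure top + bnk-2's
independent tops), so P1's weak local step (`SahiCoSunflowerTwoLevel.sahiE_three_nonneg_of_weakTwoLevelAt`) gives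
`E_3(A,B,C) ≥ (1−q_e)²·E_3(A⁰,B⁰,C⁰) + q_e²·E_3(A¹,B¹,C¹) ≥ 0` as soon as the two section triples satisfy Kahn's inequality.

THE RECURSION (`sahiE3_nonneg_of_recursivelyAbsorbing`).  Consequently every predicate `P S U` on (coordinate set, triple) that always
certifies one of — (a) some member contains the meet of the other two (Kahn's inequality holds outright: lane P3's
`SahiAbsorbed.kahn_sahiE3_nonneg_of_inter_subset`), (b) some `e ∈ S` is inessential for all three members and `P (S ∖ e) U`, (c) some
`e ∈ S` has top-absorbing `1`-sections and `P (S ∖ e)` holds for BOTH section triples — implies `E_3(U) ≥ 0` for every increasing triple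
determined by `S` with `P S U` (strong induction on `|S|`).  The smallest such `P` is the RECURSIVELY-ABSORBING class 𝒦.

CENSUS (this seat, code/gen21/classK.py, goodcoord.py; memo §8): 𝒦 contains ALL 1 540 unordered triples of up-sets of `{0,1}^3`, all of
2·10⁵ random triples on `{0,1}^4`, 99 999 of 10⁵ on `{0,1}^5` (the exception: `(x1x2∨x0x3, x2x3∨x1x4, x0x1∨x3x4)`), 99.91 % of 3·10⁴ on
`{0,1}^6`; among random value-level ANTICHAIN triples (not covered by (a)) a top-absorbing coordinate exists in 99 998/10⁵ (`{0,1}^4`),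
60 000/60 000 (`{0,1}^5`), 19 939/20 000 (`{0,1}^6`) cases.  So the two kernel ingredients (a) [P3] and (c) [this lane, gen 21] already
prove Kahn's inequality, by this recursion, for all but a thin explicit family of triples on `≤ 6` coins — the honest residual of Kahn's
Conjecture 5 under this decomposition (listed in the memo; smallest member on 5 coins above; includes the mutually independent
`(x0x3, x1x2, x4x5)`-type triples, where `E_3 = 0`, which other kernel faces handle).
HONEST LABEL: Kahn's Conjecture 5 / `SahiTwoLevelPlus` remain OPEN; this file proves the inequality on a (large, recursively defined) class. [this work]
-/

noncomputable section

open scoped Classical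

namespace Summit.CriticalPhenomena.PercolationContinuityZ3.Theorems

namespace SahiTwoLevelVariational

open Finset Function MeasureTheory
open Literature.Combinatorics.Sahi2008
open Literature.Probability.LatticeModels (prodBernoulli prodBernoulli_harris sahiE3 sahiE3_def)
open Literature.Probability.Percolation (DeterminedBy determinedBy_iff)
open Literature.Probability.Percolation.DecisionTree (ind ind_of_mem ind_of_not_mem ind_nonneg)
open SahiCoordinateBernstein (coordPiece₂)

variable {κ : Type} [Fintype κ]

/-! ### 1. The step: a top-absorbing coordinate is a good coordinate -/

/-- **A TOP-ABSORBING COORDINATE IS A GOOD COORDINATE.**  For increasing `A, B, C` and a coordinate `e`: if one of the `1`-sections along `e`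
contains the meet of the other two, and the two section triples satisfy Kahn's inequality, then `E_3(μ_q; A, B, C) ≥ 0`. [this work] -/
theorem sahiE3_nonneg_of_topAbsorbingAt (q : κ → unitInterval) (e : κ) {A B C : Set (Set κ)}
    (hA : IsUpperSet A) (hB : IsUpperSet B) (hC : IsUpperSet C)
    (habs : secAt e true B ∩ secAt e true C ⊆ secAt e true A ∨ secAt e true C ∩ secAt e true A ⊆ secAt e true B
      ∨ secAt e true A ∩ secAt e true B ⊆ secAt e true C)
    (h0 : 0 ≤ sahiE3 (prodBernoulli q) (secAt e false A) (secAt e false B) (secAt e false C))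
    (h1 : 0 ≤ sahiE3 (prodBernoulli q) (secAt e true A) (secAt e true B) (secAt e true C)) :
    0 ≤ sahiE3 (prodBernoulli q) A B C := by
  set G : Fin 3 → Set (Set κ) := ![secAt e true A, secAt e true B, secAt e true C] with hGdef
  set H : Fin 3 → Set (Set κ) := ![secAt e false A, secAt e false B, secAt e false C] with hHdef
  have hGup : ∀ i, IsUpperSet (G i) := by
    intro i; fin_cases i
    · exact isUpperSet_secAt e true hA
    · exact isUpperSet_secAt e true hB
    · exact isUpperSet_secAt e true hC
  have hHup : ∀ i, IsUpperSet (H i) := by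
    intro i; fin_cases i
    · exact isUpperSet_secAt e false hA
    · exact isUpperSet_secAt e false hB
    · exact isUpperSet_secAt e false hC
  have hHG : ∀ i, H i ⊆ G i := by
    intro i; fin_cases i
    · exact SahiTwoLevel.secAt_false_subset_true e hA
    · exact SahiTwoLevel.secAt_false_subset_true e hB
    · exact SahiTwoLevel.secAt_false_subset_true e hC
  have habs' : G 1 ∩ G 2 ⊆ G 0 ∨ G 2 ∩ G 0 ⊆ G 1 ∨ G 0 ∩ G 1 ⊆ G 2 := by
    simpa [hGdef] using habs
  have hT : 0 ≤ topForm q G H := by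
    rw [topForm_def]
    exact twoLevelPlus_nonneg_of_topAbsorbing q G H hGup hHup hHG habs'
  rw [← sahiE_three_ind] at h0 h1 ⊢
  have hb := SahiTwoLevel.coordPiece₂_add_eq_twoLevelPlus q e A B C
  simp only [ex_bernoulliWeight_ind] at hb
  have hW : 0 ≤ coordPiece₂ q e ![A, B, C]
      + sahiE (bernoulliWeight q) 3 ![ind (secAt e false A), ind (secAt e false B), ind (secAt e false C)]
      + sahiE (bernoulliWeight q) 3 ![ind (secAt e true A), ind (secAt e true B), ind (secAt e true C)] := by
    rw [hb]
    simpa [topForm, hGdef, hHdef] using hT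
  exact SahiCoSunflowerTwoLevel.sahiE_three_nonneg_of_weakTwoLevelAt q e hA hB hC hW h0 h1

/-! ### 2. The recursion: Kahn's inequality on every recursively certified class -/

/-- The three certificates of the recursion for a triple `U` and a coordinate set `S`, relative to a predicate `P`:
(a) absorbing head; (b) an inessential coordinate `e ∈ S` with `P (S.erase e) U`; (c) a coordinate `e ∈ S` with top-absorbing `1`-sections and
`P (S.erase e)` for both section triples. [this work] -/
theorem sahiE3_nonneg_of_recursivelyAbsorbing (q : κ → unitInterval) (P : Finset κ → (Fin 3 → Set (Set κ)) → Prop)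
    (hP : ∀ (S : Finset κ) (U : Fin 3 → Set (Set κ)), P S U →
      (∃ i : Fin 3, ∀ ω : Set κ, (∀ k : Fin 3, k ≠ i → ω ∈ U k) → ω ∈ U i)
      ∨ (∃ e ∈ S, (∀ i, DeterminedBy (U i) (↑(S.erase e) : Set κ)) ∧ P (S.erase e) U)
      ∨ (∃ e ∈ S,
          (secAt e true (U 1) ∩ secAt e true (U 2) ⊆ secAt e true (U 0)
            ∨ secAt e true (U 2) ∩ secAt e true (U 0) ⊆ secAt e true (U 1)
            ∨ secAt e true (U 0) ∩ secAt e true (U 1) ⊆ secAt e true (U 2))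
          ∧ P (S.erase e) ![secAt e true (U 0), secAt e true (U 1), secAt e true (U 2)]
          ∧ P (S.erase e) ![secAt e false (U 0), secAt e false (U 1), secAt e false (U 2)])) :
    ∀ (S : Finset κ) (U : Fin 3 → Set (Set κ)), P S U → (∀ i, IsUpperSet (U i)) → (∀ i, DeterminedBy (U i) (↑S : Set κ)) →
      0 ≤ sahiE3 (prodBernoulli q) (U 0) (U 1) (U 2) := by
  suffices key : ∀ (m : ℕ) (S : Finset κ) (U : Fin 3 → Set (Set κ)), S.card = m → P S U → (∀ i, IsUpperSet (U i)) →
      (∀ i, DeterminedBy (U i) (↑S : Set κ)) → 0 ≤ sahiE3 (prodBernoulli q) (U 0) (U 1) (U 2) from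
    fun S U hPU hU hUS => key _ S U rfl hPU hU hUS
  intro m
  induction m using Nat.strong_induction_on with
  | _ m ih =>
  intro S U hS hPU hU hUS
  rcases hP S U hPU with ⟨i, hi⟩ | ⟨e, heS, hdet, hPe⟩ | ⟨e, heS, habs, hP1, hP0⟩
  · -- (a) absorbing head: lane P3's theorem
    refine SahiAbsorbed.kahn_sahiE3_nonneg_of_inter_subset q (U 0) (U 1) (U 2) (hU 0) (hU 1) (hU 2) i fun ω hω => ?_
    have h := hi ω fun k hk => by
      have := hω k hk
      fin_cases k <;> simpa using this
    fin_cases i <;> simpa using h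
  · -- (b) inessential coordinate: same triple, smaller determining set
    have hlt : (S.erase e).card < m := by rw [← hS]; exact Finset.card_erase_lt_of_mem heS
    exact ih _ hlt (S.erase e) U rfl hPe hU hdet
  · -- (c) top-absorbing coordinate: both section triples by induction, then the step
    have hlt : (S.erase e).card < m := by rw [← hS]; exact Finset.card_erase_lt_of_mem heS
    have h1 : 0 ≤ sahiE3 (prodBernoulli q) (secAt e true (U 0)) (secAt e true (U 1)) (secAt e true (U 2)) := by
      have := ih _ hlt (S.erase e) ![secAt e true (U 0), secAt e true (U 1), secAt e true (U 2)] rfl hP1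
        (fun i => by fin_cases i <;> exact isUpperSet_secAt e true (hU _))
        (fun i => by fin_cases i <;> exact determinedBy_secAt e true (hUS _))
      simpa using this
    have h0 : 0 ≤ sahiE3 (prodBernoulli q) (secAt e false (U 0)) (secAt e false (U 1)) (secAt e false (U 2)) := by
      have := ih _ hlt (S.erase e) ![secAt e false (U 0), secAt e false (U 1), secAt e false (U 2)] rfl hP0
        (fun i => by fin_cases i <;> exact isUpperSet_secAt e false (hU _))
        (fun i => by fin_cases i <;> exact determinedBy_secAt e false (hUS _))
      simpa using this
    exact sahiE3_nonneg_of_topAbsorbingAt q e (hU 0) (hU 1) (hU 2) habs h0 h1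

/-- **Kahn's inequality on the recursively-absorbing class, cube form**: if `P univ U` for a predicate `P` as above, then `E_3(μ_q; U) ≥ 0`. [this work] -/
theorem sahiE3_nonneg_of_recursivelyAbsorbing_univ (q : κ → unitInterval) (P : Finset κ → (Fin 3 → Set (Set κ)) → Prop)
    (hP : ∀ (S : Finset κ) (U : Fin 3 → Set (Set κ)), P S U →
      (∃ i : Fin 3, ∀ ω : Set κ, (∀ k : Fin 3, k ≠ i → ω ∈ U k) → ω ∈ U i)
      ∨ (∃ e ∈ S, (∀ i, DeterminedBy (U i) (↑(S.erase e) : Set κ)) ∧ P (S.erase e) U)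
      ∨ (∃ e ∈ S,
          (secAt e true (U 1) ∩ secAt e true (U 2) ⊆ secAt e true (U 0)
            ∨ secAt e true (U 2) ∩ secAt e true (U 0) ⊆ secAt e true (U 1)
            ∨ secAt e true (U 0) ∩ secAt e true (U 1) ⊆ secAt e true (U 2))
          ∧ P (S.erase e) ![secAt e true (U 0), secAt e true (U 1), secAt e true (U 2)]
          ∧ P (S.erase e) ![secAt e false (U 0), secAt e false (U 1), secAt e false (U 2)]))
    (U : Fin 3 → Set (Set κ)) (hPU : P Finset.univ U) (hU : ∀ i, IsUpperSet (U i)) :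
    0 ≤ sahiE3 (prodBernoulli q) (U 0) (U 1) (U 2) :=
  sahiE3_nonneg_of_recursivelyAbsorbing q P hP Finset.univ U hPU hU fun _ => determinedBy_univ _

end SahiTwoLevelVariational

end Summit.CriticalPhenomena.PercolationContinuityZ3.Theorems
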